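import Summits.HodgeConjecture.CorCM.StabiliserOrbitReflexSlot
import Summits.HodgeConjecture.CorCM.DoubleFlipCMFieldsHodge
import HarnessLib

/-!
# THE REFLEX SLOT OF A DOUBLE-FLIP BASE: with double flips and conjugate types at EVEN Hamming distance, `Stab(x₀)` is
# transitive on the reflex type, and the incidence criterion holds — reflex fields of HALF degree (`2ⁿ⁻¹`)

COR-CM (cell `pub-hodgecm2`, binder seat `b16` gen 53, count-neutral claim ORBIT-CRITERION, file F8 — abstract `G`-set
level; theorems only, no definition, no named fact, no `sorry`).  NEW as stated, hence under `Summits/`.  HONEST FRAMING: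
finite-dimensional linear algebra about the Kubota–Dodson rank of pairs of CM types; `HC_CM` is neither used nor asserted.

F4a (`StabiliserOrbitReflexSlot`) proved, for a base slot with PAIR flips, that `Stab(x₀)` is transitive on the reflex type
`Φ₀* = {y : x₀ ∈ T y}` of a reflex slot `(Y, T)` (induction on the Hamming distance, one flip at a time).  With DOUBLE flips
only (the even sign kernel — gen 46 `DoubleFlipCMFieldsHodge`: `U(Φ₀)` is still irreducible and every type nondegenerate as
soon as there are `≥ 3` pairs) single steps are not available, but TWO points of the difference set can be flipped at once;
this suffices exactly when all translates of `Φ₀` lie at EVEN Hamming distance from each other (hypothesis (EV):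
`#(T y ∖ T y')` even for all `y, y'`) — the case where the sign image of `G` is the even kernel itself, so that the orbit of
`Φ₀` has `2ⁿ⁻¹ · (…)` elements and the REFLEX FIELD HAS HALF THE GENERIC DEGREE (for `n = 4` and Galois group `W(D₄)` of
order 192: an OCTIC reflex field — the triality twin of the base octic).

* §1 **`exists_stab_smul_eq_of_mem_typeMap_of_doubleFlip`** — double flips + (EV) ⟹ `Stab(x₀)` transitive on `Φ₀*`
  (strong induction on `#(T y ∖ T y')`, removing two points per double flip; neither is in the pair of `x₀`).
* §2 **`typeRank_sigmaType_eq_iff_of_doubleFlip_of_typeMap`**, `typeRank_sigmaType_add_card_eq_iff_of_doubleFlip_of_typeMap`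
  — `I = {i₀, i₁}`, `≥ 3` pairs, double flips and (EV) on the base, `T` a type map on `E_{i₁}`: `Σ` nondegenerate IFF `Φ_{i₁}`
  nondegenerate AND the incidence numbers `#{y ∈ Φ_{i₁} : x ∈ T y}` are NOT constant-unequal on / off `Φ_{i₀}`
  (resp. `Hg(A₀ × A₁) = Hg(A₀) × Hg(A₁)` IFF not constant-unequal).  Sequel (CM fields): `StabiliserOrbitDoubleFlipReflex`.

## References

* [Dodson1984] B. Dodson, *The structure of Galois groups of CM-fields*, Trans. AMS 283 (1984), §1 (Reflex Degree
  Theorem), §1.1, §5.1, §5.2.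
* [Shimura1998] G. Shimura, *Abelian Varieties with Complex Multiplication and Modular Functions*, §8.3 Prop. 28.
* [Gordon1999HodgeAVSurvey] B. B. Gordon, *A survey of the Hodge conjecture for abelian varieties*, §3 Theorem, 7.5–7.7,
  9.4.3.
-/

set_option autoImplicit false

noncomputable section

open scoped BigOperators

universe u v

namespace Summit.HodgeConjecture.CorCM

namespace ReflexSlot

open Literature.NumberTheory.ComplexMultiplication
open scoped Classical

variable {G : Type u} [Group G]

/-! ### §1 Transitivity of the stabiliser on the reflex type from double flips -/

section Abstract

variable {Z Y : Type*} [MulAction G Z] [MulAction G Y] {ρ : G} {Φ₀ : Set Z} {T : Y → Set Z} {y₀ : Y}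

/-- **`Stab(x₀)` is transitive on the translates containing `x₀`, from DOUBLE flips and EVEN distances**: two points `y, y'`
with `x₀ ∈ T(y) ∩ T(y')` differ by a product of double flips at pairs of points of `T y ∖ T y'` (never the pair of `x₀`).
[cite: Dodson1984, §1.1 and §5.1] -/
theorem exists_stab_smul_eq_of_mem_typeMap_of_doubleFlip [Fintype Z] (hΦ : IsCMTypeWith ρ Φ₀)
    (hT : ∀ (g : G) (y : Y) (x : Z), x ∈ T (g • y) ↔ g⁻¹ • x ∈ T y) (hTi : Function.Injective T)
    (hT₀ : T y₀ = Φ₀) (hY : ∀ y : Y, ∃ g : G, g • y₀ = y)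
    (hflip : ∀ x t : Z, t ≠ x → t ≠ ρ • x → ∃ φ : G, φ • x = ρ • x ∧ φ • t = ρ • t ∧
      ∀ u : Z, u ≠ x → u ≠ ρ • x → u ≠ t → u ≠ ρ • t → φ • u = u)
    (heven : ∀ y y' : Y, Even (Finset.univ.filter fun x : Z => x ∈ T y ∧ x ∉ T y').card)
    {x₀ : Z} {y y' : Y} (hy : x₀ ∈ T y) (hy' : x₀ ∈ T y') : ∃ g : G, g • x₀ = x₀ ∧ g • y = y' := by
  suffices key : ∀ (n : ℕ) (y : Y), (Finset.univ.filter fun x : Z => x ∈ T y ∧ x ∉ T y').card = n →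
      x₀ ∈ T y → ∃ g : G, g • x₀ = x₀ ∧ g • y = y' from key _ y rfl hy
  intro n
  induction n using Nat.strong_induction_on with
  | _ n ih =>
    intro y hcard hy
    by_cases hn : n = 0
    · subst hn
      refine ⟨1, one_smul _ _, ?_⟩
      rw [one_smul]
      have hnone : ∀ x : Z, ¬ (x ∈ T y ∧ x ∉ T y') := by
        intro x hx
        have hmem : x ∈ (Finset.univ.filter fun x : Z => x ∈ T y ∧ x ∉ T y') := by
          rw [Finset.mem_filter]
          exact ⟨Finset.mem_univ _, hx⟩
        rw [Finset.card_eq_zero] at hcard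
        rw [hcard] at hmem
        exact Finset.notMem_empty _ hmem
      apply hTi
      ext x
      constructor
      · intro hx
        by_contra hx'
        exact hnone x ⟨hx, hx'⟩
      · intro hx'
        by_contra hx
        exact hnone (ρ • x) ⟨(rho_smul_mem_typeMap_iff hΦ hT hT₀ hY y x).2 hx,
          fun h => (rho_smul_mem_typeMap_iff hΦ hT hT₀ hY y' x).1 h hx'⟩
    · -- two distinct points `x, t` of the (even, non-empty) difference set
      have h2 : 2 ≤ n := by
        obtain ⟨m, hm⟩ := heven y y'
        rw [hcard] at hm
        omega
      obtain ⟨x, hxmem, t, htmem, hxt⟩ : ∃ x ∈ (Finset.univ.filter fun x : Z => x ∈ T y ∧ x ∉ T y'),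
          ∃ t ∈ (Finset.univ.filter fun x : Z => x ∈ T y ∧ x ∉ T y'), x ≠ t := by
        rw [← Finset.one_lt_card, hcard]
        omega
      have hx := (Finset.mem_filter.1 hxmem).2
      have ht := (Finset.mem_filter.1 htmem).2
      obtain ⟨hxy, hxy'⟩ := hx
      obtain ⟨hty, hty'⟩ := ht
      have hρx_y : ρ • x ∉ T y := fun h => (rho_smul_mem_typeMap_iff hΦ hT hT₀ hY y x).1 h hxy
      have hρx_y' : ρ • x ∈ T y' := (rho_smul_mem_typeMap_iff hΦ hT hT₀ hY y' x).2 hxy'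
      have hρt_y : ρ • t ∉ T y := fun h => (rho_smul_mem_typeMap_iff hΦ hT hT₀ hY y t).1 h hty
      have hρt_y' : ρ • t ∈ T y' := (rho_smul_mem_typeMap_iff hΦ hT hT₀ hY y' t).2 hty'
      have htρx : t ≠ ρ • x := fun h => hρx_y (h ▸ hty)
      have hx₀x : x₀ ≠ x := fun h => hxy' (h ▸ hy')
      have hx₀ρx : x₀ ≠ ρ • x := fun h => hρx_y (h ▸ hy)
      have hx₀t : x₀ ≠ t := fun h => hty' (h ▸ hy')
      have hx₀ρt : x₀ ≠ ρ • t := fun h => hρt_y (h ▸ hy)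
      obtain ⟨φ, hφx, hφt, hφ⟩ := hflip x t (Ne.symm hxt) htρx
      -- coordinates of `φ • y`
      have hcoord : ∀ u : Z, u ≠ x → u ≠ ρ • x → u ≠ t → u ≠ ρ • t → (u ∈ T (φ • y) ↔ u ∈ T y) :=
        fun u h1 h2 h3 h4 => mem_typeMap_smul_iff_of_smul_eq hT (hφ u h1 h2 h3 h4) y
      have hcx : x ∉ T (φ • y) := fun h =>
        (mem_typeMap_smul_iff_of_smul_rho_eq hΦ hT hT₀ hY (smul_rho_eq_of_pairFlip hΦ hφx) y).1 h hxy
      have hct : t ∉ T (φ • y) := fun h =>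
        (mem_typeMap_smul_iff_of_smul_rho_eq hΦ hT hT₀ hY (smul_rho_eq_of_pairFlip hΦ hφt) y).1 h hty
      have hcρx : ρ • x ∈ T (φ • y) := by
        have hφρ : φ • ρ • (ρ • x) = ρ • x := by rw [hΦ.invol, hφx]
        exact (mem_typeMap_smul_iff_of_smul_rho_eq hΦ hT hT₀ hY hφρ y).2 hρx_y
      have hcρt : ρ • t ∈ T (φ • y) := by
        have hφρ : φ • ρ • (ρ • t) = ρ • t := by rw [hΦ.invol, hφt]
        exact (mem_typeMap_smul_iff_of_smul_rho_eq hΦ hT hT₀ hY hφρ y).2 hρt_y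
      -- the difference set loses exactly `x` and `t`
      have hD : (Finset.univ.filter fun u : Z => u ∈ T (φ • y) ∧ u ∉ T y') =
          ((Finset.univ.filter fun u : Z => u ∈ T y ∧ u ∉ T y').erase x).erase t := by
        ext u
        simp only [Finset.mem_erase, Finset.mem_filter, Finset.mem_univ, true_and]
        by_cases h1 : u = x
        · subst h1
          exact ⟨fun h => absurd h.1 hcx, fun h => absurd rfl h.2.1⟩
        · by_cases h3 : u = t
          · subst h3
            exact ⟨fun h => absurd h.1 hct, fun h => absurd rfl h.1⟩
          · by_cases h2 : u = ρ • x
            · subst h2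
              exact ⟨fun h => absurd hρx_y' h.2, fun h => absurd h.2.2.1 hρx_y⟩
            · by_cases h4 : u = ρ • t
              · subst h4
                exact ⟨fun h => absurd hρt_y' h.2, fun h => absurd h.2.2.1 hρt_y⟩
              · rw [hcoord u h1 h2 h3 h4]
                exact ⟨fun h => ⟨h3, h1, h⟩, fun h => h.2.2⟩
      have htmem' : t ∈ (Finset.univ.filter fun u : Z => u ∈ T y ∧ u ∉ T y').erase x :=
        Finset.mem_erase.2 ⟨Ne.symm hxt, htmem⟩
      have hcard' : (Finset.univ.filter fun u : Z => u ∈ T (φ • y) ∧ u ∉ T y').card = n - 2 := by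
        rw [hD, Finset.card_erase_of_mem htmem', Finset.card_erase_of_mem hxmem, hcard]
        omega
      have hy₁ : x₀ ∈ T (φ • y) := (hcoord x₀ hx₀x hx₀ρx hx₀t hx₀ρt).2 hy
      obtain ⟨g', hg'x, hg'y⟩ := ih (n - 2) (by omega) (φ • y) hcard' hy₁
      refine ⟨g' * φ, ?_, ?_⟩
      · rw [mul_smul, hφ x₀ hx₀x hx₀ρx hx₀t hx₀ρt, hg'x]
      · rw [mul_smul, hg'y]

end Abstract

/-! ### §2 Families: the criterion for a double-flip base against its reflex slot -/

section Family

variable {I : Type v} {E : I → Type v} [∀ i, MulAction G (E i)] [DecidableEq I] [Fintype I] [∀ i, Fintype (E i)]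
  {ρ : G} {Φ : ∀ i, Set (E i)} {i₀ i₁ : I} [Nonempty I] [∀ i, Nonempty (E i)]
  {T : E i₁ → Set (E i₀)} {y₀ : E i₁}

/-- **THE REFLEX-SLOT CRITERION FOR A DOUBLE-FLIP BASE (nondegeneracy form).**  `I = {i₀, i₁}`, `≥ 3` pairs, double flips
and even distances (EV) on `E_{i₀}`, `T` a type map: `Σ` is nondegenerate IFF `Φ_{i₁}` is nondegenerate AND the incidence
numbers `#{y ∈ Φ_{i₁} : x ∈ T y}` are NOT `a` on `Φ_{i₀}`, `b` off `Φ_{i₀}` with `a ≠ b`.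
[cite: Gordon1999HodgeAVSurvey, §3 Theorem, 7.5–7.7 and 9.4.3] [cite: Dodson1984, §1.1, §5.1 and §5.2] -/
theorem typeRank_sigmaType_eq_iff_of_doubleFlip_of_typeMap [MulAction.IsPretransitive G (E i₀)]
    (h : ∀ i, IsCMTypeWith ρ (Φ i)) (hI : ∀ j, j = i₀ ∨ j = i₁) (h01 : i₀ ≠ i₁) (h6 : 6 ≤ Fintype.card (E i₀))
    (hflip : ∀ x t : E i₀, t ≠ x → t ≠ ρ • x → ∃ φ : G, φ • x = ρ • x ∧ φ • t = ρ • t ∧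
      ∀ u : E i₀, u ≠ x → u ≠ ρ • x → u ≠ t → u ≠ ρ • t → φ • u = u)
    (hT : ∀ (g : G) (y : E i₁) (x : E i₀), x ∈ T (g • y) ↔ g⁻¹ • x ∈ T y) (hTi : Function.Injective T)
    (hT₀ : T y₀ = Φ i₀) (hY : ∀ y : E i₁, ∃ g : G, g • y₀ = y)
    (heven : ∀ y y' : E i₁, Even (Finset.univ.filter fun x : E i₀ => x ∈ T y ∧ x ∉ T y').card) :
    typeRank G (sigmaType Φ) = Fintype.card (Σ i, E i) / 2 + 1 ↔
      typeRank G (Φ i₁) = Fintype.card (E i₁) / 2 + 1 ∧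
        ¬ ∃ a b : ℕ, a ≠ b ∧ ∀ x : E i₀,
          (Finset.univ.filter fun y : E i₁ => y ∈ Φ i₁ ∧ x ∈ T y).card = if x ∈ Φ i₀ then a else b := by
  obtain ⟨x₀⟩ := (inferInstance : Nonempty (E i₀))
  have hO : ∀ y ∈ {y : E i₁ | x₀ ∈ T y}, ∀ y' ∈ {y : E i₁ | x₀ ∈ T y}, ∃ g : G, g • x₀ = x₀ ∧ g • y = y' :=
    fun y hy y' hy' => exists_stab_smul_eq_of_mem_typeMap_of_doubleFlip (h i₀) hT hTi hT₀ hY hflip heven hy hy'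
  have hoff : ∀ y : E i₁, y ∉ {y : E i₁ | x₀ ∈ T y} → ρ • y ∉ {y : E i₁ | x₀ ∈ T y} →
      ∃ σ : G, σ • x₀ = ρ • x₀ ∧ σ • y = y :=
    fun y hy hρy => ((mem_typeMap_or_mem_typeMap_rho_smul (h i₀) hT hT₀ hY x₀ y).elim hy hρy).elim
  rw [Shadow.typeRank_sigmaType_eq_iff_not_exists_orbitMultiplicities h hI h01
    (DoubleFlip.antiSpan_irreducible_of_doubleFlip (h i₀) h6 hflip) (DoubleFlip.typeRank_eq_of_doubleFlip (h i₀) h6 hflip)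
    {y : E i₁ | x₀ ∈ T y} hO hoff]
  refine and_congr Iff.rfl (not_congr (exists_congr fun a => exists_congr fun b => and_congr Iff.rfl ?_))
  constructor
  · intro hg x
    obtain ⟨g, rfl⟩ := MulAction.exists_smul_eq G x₀ x
    rw [← card_filter_mem_typeMap_smul_eq hT x₀ (Φ i₁) g]
    exact hg g
  · intro hx g
    exact (card_filter_mem_typeMap_smul_eq hT x₀ (Φ i₁) g).trans (hx (g • x₀))

/-- **THE REFLEX-SLOT CRITERION FOR A DOUBLE-FLIP BASE (rank form)**: `rank(Σ) + |I| = Σ_i rank(Φ_i) + 1`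
(`Hg(A₀ × A₁) = Hg(A₀) × Hg(A₁)`) IFF the incidence numbers are not constant-unequal.
[cite: Gordon1999HodgeAVSurvey, §3 Theorem (1), 7.5–7.7 and 9.4.3] [cite: Dodson1984, §1.1 and §5.1] -/
theorem typeRank_sigmaType_add_card_eq_iff_of_doubleFlip_of_typeMap [MulAction.IsPretransitive G (E i₀)]
    (h : ∀ i, IsCMTypeWith ρ (Φ i)) (hI : ∀ j, j = i₀ ∨ j = i₁) (h01 : i₀ ≠ i₁) (h6 : 6 ≤ Fintype.card (E i₀))
    (hflip : ∀ x t : E i₀, t ≠ x → t ≠ ρ • x → ∃ φ : G, φ • x = ρ • x ∧ φ • t = ρ • t ∧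
      ∀ u : E i₀, u ≠ x → u ≠ ρ • x → u ≠ t → u ≠ ρ • t → φ • u = u)
    (hT : ∀ (g : G) (y : E i₁) (x : E i₀), x ∈ T (g • y) ↔ g⁻¹ • x ∈ T y) (hTi : Function.Injective T)
    (hT₀ : T y₀ = Φ i₀) (hY : ∀ y : E i₁, ∃ g : G, g • y₀ = y)
    (heven : ∀ y y' : E i₁, Even (Finset.univ.filter fun x : E i₀ => x ∈ T y ∧ x ∉ T y').card) :
    typeRank G (sigmaType Φ) + Fintype.card I = (∑ i, typeRank G (Φ i)) + 1 ↔
      ¬ ∃ a b : ℕ, a ≠ b ∧ ∀ x : E i₀,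
        (Finset.univ.filter fun y : E i₁ => y ∈ Φ i₁ ∧ x ∈ T y).card = if x ∈ Φ i₀ then a else b := by
  obtain ⟨x₀⟩ := (inferInstance : Nonempty (E i₀))
  have hO : ∀ y ∈ {y : E i₁ | x₀ ∈ T y}, ∀ y' ∈ {y : E i₁ | x₀ ∈ T y}, ∃ g : G, g • x₀ = x₀ ∧ g • y = y' :=
    fun y hy y' hy' => exists_stab_smul_eq_of_mem_typeMap_of_doubleFlip (h i₀) hT hTi hT₀ hY hflip heven hy hy'
  have hoff : ∀ y : E i₁, y ∉ {y : E i₁ | x₀ ∈ T y} → ρ • y ∉ {y : E i₁ | x₀ ∈ T y} →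
      ∃ σ : G, σ • x₀ = ρ • x₀ ∧ σ • y = y :=
    fun y hy hρy => ((mem_typeMap_or_mem_typeMap_rho_smul (h i₀) hT hT₀ hY x₀ y).elim hy hρy).elim
  rw [Shadow.typeRank_sigmaType_add_card_eq_iff_not_exists_orbitMultiplicities h hI h01
    (DoubleFlip.antiSpan_irreducible_of_doubleFlip (h i₀) h6 hflip) {y : E i₁ | x₀ ∈ T y} hO hoff]
  refine not_congr (exists_congr fun a => exists_congr fun b => and_congr Iff.rfl ?_)
  constructor
  · intro hg x
    obtain ⟨g, rfl⟩ := MulAction.exists_smul_eq G x₀ x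
    rw [← card_filter_mem_typeMap_smul_eq hT x₀ (Φ i₁) g]
    exact hg g
  · intro hx g
    exact (card_filter_mem_typeMap_smul_eq hT x₀ (Φ i₁) g).trans (hx (g • x₀))

end Family

end ReflexSlot

end Summit.HodgeConjecture.CorCM

end
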